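/-
Copyright (c) 2026 the pub-hodgecm-mathlib formalisation cell (harness21).  Prover seat hodgecm-mathlib-F0P2-p08 (g0) (re-dealt to L1 `stub_firstTermThetaPairing`;
LEAD F0P6-plan (g14) BATCH #45 «S2 (law) THE DICTIONARY»; S2 desk K2Liu-p05 (g6) head + binder bytes 15:06:49Z): Track B «K2-LIT», hLiu418 = stmt-HodgeConjecture-24832,
road `K2_Liu`, socket #42S, organ S2, road (γ), letter (law): THE SIEGEL-PARABOLIC CHARACTER OF THE DOUBLED GROUP READ ON A ONE-PLACE ARCHIMEDEAN SLICE IN TUBE LETTERS.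
-/
import Summits.HodgeConjecture.HodgeConjecture.Theorems.K2LiuArchSliceSiegel              -- ★ (desk p05) `isSiegelDelta_archPiEquivCM_symm_mulSingle_iff` (+ ★ `IsSiegelM`, `detDeltaM`)
import Literature.NumberTheory.GelbartRogawski1991.DoubledUnitaryArchSiegelModulus          -- ★ `snd∕extensionEmbedding_fst_det_deltaBlock_archToAdelic` (Kudla's `x((g,1))` place by place)
import Literature.NumberTheory.GelbartRogawski1991.DoubledUnitarySiegelParabolicAlgebra     -- ★ `isUnit_detDelta_of_isSiegelDelta`
import Literature.NumberTheory.K2Lit.SiegelEisensteinSeriesDoubled                          -- ★ `siegelDeltaCharacter χ s p = chiDet χ p · (modDelta p)^{2s+n}`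
import Literature.NumberTheory.GaloisRepresentations.HeckeCharacterExtensionQuadraticCMProofs -- ★ `HasUnitaryArchType`, `archUnitaryValue`, `CMQuadraticExtension.archUnitaryValue_zero_right`
import HarnessLib

/-!
# Crux `HLiu418`, #42S organ S2, road (γ), letter (law): the Siegel-parabolic character `χ(det_Δ p)|det_Δ p|^{s+n∕2}` of the doubled group on a ONE-PLACE archimedean
# slice, in tube-frame letters — `siegelDeltaCharacter χ′ s′ (ι_w g) = (conj z ∕ ‖z‖)^{−t_w} · ‖z‖^{2s′+n}`, `z = det (τ g)₁₁`

Cell `hodgecm-mathlib`, crux item hLiu418 = `stmt-HodgeConjecture-24832`; squad K2 ∕ K2Liu (L1 `stub_firstTermThetaPairing`, LEAD F0P6-plan (g14)); prover F0P2-p08 (g0);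
S2 desk K2Liu-p05 (g6).  THEOREMS ONLY (no `def`, no instance, no notation, no named-fact hypothesis, no `sorry`); lane `--supports stmt-HodgeConjecture-24832 --as helper`.

THE LETTER (desk bytes (T1) + companion).  Doubled CM datum `(L, e, dV, dW)` (group `H = U(J^𝔻)`, ★ `GRConstruction.HA`), a complex place `w` of `L`, an element
`g ∈ U(σ_w J^𝔻)(ℂ) = archLocal L (n+n) J^𝔻 w`, its ONE-PLACE SLICE `ι_w g := archToAdelic (archPiEquivCM⁻¹ (δ_w g)) ∈ H(𝔸)` (`g` at `w`, `1` at every other place), and a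
tube frame `T = (D D; C −C)`, `Tinv` (`Tinv · T = 1`; `D`, `C` invertible — the Shimura letters of ★ `exists_tubeFrame_arch₄` (x) have this shape), tube image
`τ g = T · g̃ · Tinv` (`g̃ = reindex e₂⁻¹ e₂⁻¹ g`).  For a Hecke character `χ′` of unitary archimedean type `(t, 0)` (★ `HasUnitaryArchType t 0`: `χ′_w(z) = (z∕‖z‖)^{t_w}`)
and `s′ ∈ ℂ`, IF `τ g` is tube-Siegel (`(τ g)₂₁ = 0`) THEN
  `siegelDeltaCharacter χ′ s′ (ι_w g) = (conj z ∕ ‖z‖)^{−t w} · ‖z‖^{2s′ + n}`,  `z = det (τ g)₁₁`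
(`det_Δ(ι_w g)` is the idele with `x_w = det(g̃₁₁ + g̃₁₂) = det (τ g)₁₁`, `x_{w′} = 1` off `w`; `|·|_w = ‖·‖²` so `modDelta = ‖z‖`; `χ′((x,1)) = (z∕‖z‖)^{t_w}`).  So the (law)
weight of the S2 packaging is `k_w = −t_w` (consumer: `χ′ := χ^{M₂}`, `t := M₂ • t_χ` ⇒ `k_w = −M₂ t_w`, K2Liu-ref1's PIN `κ_σ = M₂ t_σ`), `s = s′`.
* §1 FRAME ALGEBRA (any field-free statement over `ℂ`): `isSiegelM_and_toBlocks₁₁_mul_of_tube` — `(τ g)₂₁ = 0` forces the `Δ`-row relation ★ `IsSiegelM g` and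
  `(τ g)₁₁ · D = D · (g̃₁₁ + g̃₁₂)`; `detDeltaM_eq_det_toBlocks₁₁_of_tube` — hence ★ `detDeltaM g = det (τ g)₁₁`.
* §2 THE SLICE: `archAt_slice` (`(ι_w g)_{w′} = δ_w g w′`), **`isSiegelDelta_slice_of_toBlocks₂₁`** (the companion: tube-Siegel ⇒ `ι_w g ∈ P_Δ(𝔸)`, via ★ desk letter
  `isSiegelDelta_archPiEquivCM_symm_mulSingle_iff`), `detDeltaM_archAt_slice_of_ne ∕ _self` (Kudla's `x` of the place components: `1` off `w`, `det (τ g)₁₁` at `w`).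
* §3 THE IDELE `det_Δ(ι_w g)`: `snd_detDelta_slice` (finite part `1`), `extensionEmbedding_detDelta_slice` (place components), `chiDet_slice` (`= (z∕‖z‖)^{t w}`),
  `modDelta_slice` (`= ‖z‖`).
* §4 **`siegelDeltaCharacter_slice`** (raw form `(z∕‖z‖)^{t w} · ‖z‖^{2s′+n}`) and **`siegelDeltaCharacter_archPlace`** (desk head (T1), `(conj z∕‖z‖)^{−t w} · ‖z‖^{2s′+n}`).
* §5 `isUnit_det_shimuraFrame` — the explicit Shimura letters `D = diag(√(|t|∕2))`, `C₀ = diag(i e d)` of ★ `exists_tubeFrame_arch₄` (x) discharge the binders `hD`, `hC`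
  (`hinv` is its conjunct `Tinv · T = 1`), so (T1) is consumable BY NAME off the frame package.
[Kudla1994, §3 (the Siegel-parabolic character `χ(x(p))|x(p)|^{1∕2}`)]; [HarrisKudlaSweet1996, §1 (1.11)–(1.15)]; [Shimura1997, §§5–6, §16.4 (tube model, `χ_k(z) = (z̄∕|z|)^k`)];
[BorelJacquet1979, §4.1]; [TateThesis1967, §4.3]; [Patrikis2019, §2.1].
HONEST LABEL.  Count-neutral helper: `HC_CM` is proved only modulo the 7 printed citations (2 remaining named inputs: hLiu418 = `stmt-HodgeConjecture-24832`,
h413 = `stmt-HodgeConjecture-24833`) until rung 0 closes; this file closes no socket.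
-/

set_option autoImplicit false
set_option linter.dupNamespace false -- the mandated namespace repeats `HodgeConjecture.HodgeConjecture`

noncomputable section

open scoped Classical Matrix ComplexConjugate
open NumberField NumberField.InfinitePlace NumberField.mixedEmbedding IsDedekindDomain
open Literature.NumberTheory.Automorphic Literature.NumberTheory.Automorphic.UnitaryGroup
open Literature.NumberTheory.GaloisRepresentations
open Literature.NumberTheory.GelbartRogawski1991 Literature.NumberTheory.GelbartRogawski1991.GRConstruction
open Literature.NumberTheory.GelbartRogawski1991.UnitaryDualPair
open Literature.NumberTheory.K2Lit.SiegelDoubled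
open Summit.HodgeConjecture.HodgeConjecture.Cruxes.HLiu418.K2LiuArchSliceSiegel (isSiegelDelta_archPiEquivCM_symm_mulSingle_iff)

namespace Summit.HodgeConjecture.HodgeConjecture.Cruxes.HLiu418.K2LiuArchSiegelCharacterTube
/-! ## §1 Frame algebra: a tube-Siegel image forces the `Δ`-row relation and conjugates the `Δ`-block -/
section Frame
variable {n : ℕ}

/-- **TUBE-SIEGEL ⇒ `Δ`-SIEGEL, AND THE `Δ`-BLOCK IS CONJUGATE TO `(τ g)₁₁`.**  For the frame `T = (D D; C −C)` with `Tinv · T = 1` and `C` invertible: if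
`τ G = T · G̃ · Tinv` (`G̃ = reindex e₂⁻¹ e₂⁻¹ G`) has `(τ G)₂₁ = 0`, then `G̃₁₁ + G̃₁₂ = G̃₂₁ + G̃₂₂` (★ `IsSiegelM G`) and `(τ G)₁₁ · D = D · (G̃₁₁ + G̃₁₂)`
(compare the blocks of `(τ G)·T = T·G̃`: `T` carries the diagonal `Δ = {(x,x)}` onto the first summand). [cite: Shimura1997, §6] [cite: GelbartRogawski1991, §3.1] -/
theorem isSiegelM_and_toBlocks₁₁_mul_of_tube (D C : Matrix (Fin n) (Fin n) ℂ) (Tinv : Matrix (Fin n ⊕ Fin n) (Fin n ⊕ Fin n) ℂ)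
    (hinv : Tinv * Matrix.fromBlocks D D C (-C) = 1) (hC : IsUnit C.det) (G : Matrix (Fin (n + n)) (Fin (n + n)) ℂ)
    (hP : (Matrix.fromBlocks D D C (-C) * Matrix.reindex (e₂ (n := n)).symm (e₂ (n := n)).symm G * Tinv).toBlocks₂₁ = 0) :
    IsSiegelM (n := n) G ∧
      (Matrix.fromBlocks D D C (-C) * Matrix.reindex (e₂ (n := n)).symm (e₂ (n := n)).symm G * Tinv).toBlocks₁₁ * D =
        D * ((Matrix.reindex (e₂ (n := n)).symm (e₂ (n := n)).symm G).toBlocks₁₁ + (Matrix.reindex (e₂ (n := n)).symm (e₂ (n := n)).symm G).toBlocks₁₂) := by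
  set T : Matrix (Fin n ⊕ Fin n) (Fin n ⊕ Fin n) ℂ := Matrix.fromBlocks D D C (-C) with hT
  set Gt : Matrix (Fin n ⊕ Fin n) (Fin n ⊕ Fin n) ℂ := Matrix.reindex (e₂ (n := n)).symm (e₂ (n := n)).symm G with hGt
  set P : Matrix (Fin n ⊕ Fin n) (Fin n ⊕ Fin n) ℂ := T * Gt * Tinv with hPdef
  have hPT : P * T = T * Gt := by
    rw [hPdef, Matrix.mul_assoc (T * Gt), hinv, Matrix.mul_one]
  have hPb : P = Matrix.fromBlocks P.toBlocks₁₁ P.toBlocks₁₂ 0 P.toBlocks₂₂ := by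
    conv_lhs => rw [← Matrix.fromBlocks_toBlocks P]
    rw [hP]
  have hGb : Gt = Matrix.fromBlocks Gt.toBlocks₁₁ Gt.toBlocks₁₂ Gt.toBlocks₂₁ Gt.toBlocks₂₂ := (Matrix.fromBlocks_toBlocks Gt).symm
  rw [hPb, hGb, hT, Matrix.fromBlocks_multiply, Matrix.fromBlocks_multiply] at hPT
  obtain ⟨h11, h12, h21, h22⟩ := Matrix.fromBlocks_inj.1 hPT
  have hCu : IsUnit C := (Matrix.isUnit_iff_isUnit_det C).2 hC
  have hS : Gt.toBlocks₁₁ + Gt.toBlocks₁₂ = Gt.toBlocks₂₁ + Gt.toBlocks₂₂ := by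
    refine hCu.mul_left_cancel ?_
    have hsum : C * Gt.toBlocks₁₁ + -C * Gt.toBlocks₂₁ + (C * Gt.toBlocks₁₂ + -C * Gt.toBlocks₂₂) = 0 := by
      rw [← h21, ← h22]
      simp only [Matrix.zero_mul, zero_add, Matrix.mul_neg, add_neg_cancel]
    rw [Matrix.mul_add, Matrix.mul_add, ← sub_eq_zero]
    rw [← hsum]
    simp only [Matrix.neg_mul]
    abel
  refine ⟨hS, ?_⟩
  have htop : P.toBlocks₁₁ * D + P.toBlocks₁₁ * D = D * (Gt.toBlocks₁₁ + Gt.toBlocks₁₂) + D * (Gt.toBlocks₁₁ + Gt.toBlocks₁₂) := by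
    have hadd : P.toBlocks₁₁ * D + P.toBlocks₁₂ * C + (P.toBlocks₁₁ * D + P.toBlocks₁₂ * -C) =
        D * Gt.toBlocks₁₁ + D * Gt.toBlocks₂₁ + (D * Gt.toBlocks₁₂ + D * Gt.toBlocks₂₂) := by rw [h11, h12]
    have hlhs : P.toBlocks₁₁ * D + P.toBlocks₁₂ * C + (P.toBlocks₁₁ * D + P.toBlocks₁₂ * -C) = P.toBlocks₁₁ * D + P.toBlocks₁₁ * D := by
      simp only [Matrix.mul_neg]
      abel
    have hrhs : D * Gt.toBlocks₁₁ + D * Gt.toBlocks₂₁ + (D * Gt.toBlocks₁₂ + D * Gt.toBlocks₂₂) =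
        D * (Gt.toBlocks₁₁ + Gt.toBlocks₁₂) + D * (Gt.toBlocks₂₁ + Gt.toBlocks₂₂) := by
      simp only [Matrix.mul_add]
      abel
    rw [hlhs, hrhs, ← hS] at hadd
    exact hadd
  have h2 : (2 : ℂ) • (P.toBlocks₁₁ * D) = (2 : ℂ) • (D * (Gt.toBlocks₁₁ + Gt.toBlocks₁₂)) := by
    rw [two_smul, two_smul]
    exact htop
  exact smul_right_injective _ (two_ne_zero (α := ℂ)) h2

/-- **`det_Δ g = det (τ g)₁₁`**: under the same hypotheses plus `D` invertible, Kudla's `x(g) = det(g̃₁₁ + g̃₁₂)` (★ `detDeltaM`) IS the determinant of the Levi block of the tube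
image. [cite: Kudla1994, §3] [cite: Shimura1997, §6] -/
theorem detDeltaM_eq_det_toBlocks₁₁_of_tube (D C : Matrix (Fin n) (Fin n) ℂ) (Tinv : Matrix (Fin n ⊕ Fin n) (Fin n ⊕ Fin n) ℂ)
    (hinv : Tinv * Matrix.fromBlocks D D C (-C) = 1) (hD : IsUnit D.det) (hC : IsUnit C.det) (G : Matrix (Fin (n + n)) (Fin (n + n)) ℂ)
    (hP : (Matrix.fromBlocks D D C (-C) * Matrix.reindex (e₂ (n := n)).symm (e₂ (n := n)).symm G * Tinv).toBlocks₂₁ = 0) :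
    detDeltaM (n := n) G = (Matrix.fromBlocks D D C (-C) * Matrix.reindex (e₂ (n := n)).symm (e₂ (n := n)).symm G * Tinv).toBlocks₁₁.det := by
  have h := congrArg Matrix.det (isSiegelM_and_toBlocks₁₁_mul_of_tube D C Tinv hinv hC G hP).2
  rw [Matrix.det_mul, Matrix.det_mul, mul_comm] at h
  unfold detDeltaM
  exact (hD.mul_left_cancel h).symm

/-- the Levi block of a tube-Siegel image of an INVERTIBLE matrix has non-zero determinant (`det (τ G) = det (τ G)₁₁ · det (τ G)₂₂`). [cite: Shimura1997, §6] -/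
theorem det_toBlocks₁₁_ne_zero_of_tube (T Tinv : Matrix (Fin n ⊕ Fin n) (Fin n ⊕ Fin n) ℂ) (hinv : Tinv * T = 1) (G : Matrix (Fin (n + n)) (Fin (n + n)) ℂ)
    (hG : IsUnit G.det) (hP : (T * Matrix.reindex (e₂ (n := n)).symm (e₂ (n := n)).symm G * Tinv).toBlocks₂₁ = 0) :
    (T * Matrix.reindex (e₂ (n := n)).symm (e₂ (n := n)).symm G * Tinv).toBlocks₁₁.det ≠ 0 := by
  set P := T * Matrix.reindex (e₂ (n := n)).symm (e₂ (n := n)).symm G * Tinv with hPdef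
  have hTu : IsUnit T.det := by
    have h := congrArg Matrix.det hinv
    rw [Matrix.det_mul, Matrix.det_one] at h
    exact IsUnit.of_mul_eq_one_right _ h
  have hTiu : IsUnit Tinv.det := by
    have h := congrArg Matrix.det hinv
    rw [Matrix.det_mul, Matrix.det_one] at h
    exact IsUnit.of_mul_eq_one _ h
  have hPu : IsUnit P.det := by
    rw [hPdef, Matrix.det_mul, Matrix.det_mul, Matrix.det_reindex_self]
    exact (hTu.mul hG).mul hTiu
  have hPb : P = Matrix.fromBlocks P.toBlocks₁₁ P.toBlocks₁₂ 0 P.toBlocks₂₂ := by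
    conv_lhs => rw [← Matrix.fromBlocks_toBlocks P]
    rw [hP]
  rw [hPb, Matrix.det_fromBlocks_zero₂₁] at hPu
  exact (isUnit_of_mul_isUnit_left hPu).ne_zero

end Frame

/-! ## §2 The one-place archimedean slice `ι_w g = archToAdelic (archPiEquivCM⁻¹ (δ_w g))` -/
section Slice
variable (L : Type) [Field L] [NumberField L] [IsCMField L]
variable {N M n : ℕ} (e : Fin N × Fin M ≃ Fin n)
  (dV : Fin N → L) (hdV : ∀ i, IsCMField.complexConj L (dV i) = dV i)
  (dW : Fin M → L) (hdW : ∀ i, IsCMField.complexConj L (dW i) = dW i)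
  (w : {w : InfinitePlace L // w.IsComplex})

/-- **THE PLACE COMPONENTS OF THE SLICE**: `(archPiEquivCM⁻¹ (δ_w g))_{w′} = δ_w g w′` (`= g` at `w`, `= 1` off `w`; ★ `archAt_archPiEquiv_symm`). [cite: BorelJacquet1979, §4.1] -/
theorem archAt_slice (g : archLocal L (n + n) (hermD L e dV hdV dW hdW) w) (w' : {w : InfinitePlace L // w.IsComplex}) :
    archAt (Fp L) L (IsCMField.complexConj L) (n + n) (hermD L e dV hdV dW hdW) w' (complexConj_smul_infinitePlace L w'.1) (IsCMField.complexConj_ne_one L)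
        ((archPiEquivCM (n + n) L (hermD L e dV hdV dW hdW)).symm (Pi.mulSingle w g)) =
      (Pi.mulSingle (M := fun w'' : {w : InfinitePlace L // w.IsComplex} => ↥(archLocal L (n + n) (hermD L e dV hdV dW hdW) w'')) w g) w' :=
  archAt_archPiEquiv_symm (Fp L) L (IsCMField.complexConj L) (n + n) (hermD L e dV hdV dW hdW) (IsCMField.complexConj_ne_one L)
    (complexConj_smul_infinitePlace L) (Pi.mulSingle w g) w'

/-- **THE COMPANION (tube-Siegel ⇒ `P_Δ(𝔸)`)**: for the frame `T = (D D; C −C)`, `Tinv · T = 1`, `C` invertible, if the tube image of `g ∈ U(σ_w J^𝔻)(ℂ)` is tube-Siegel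
(`(τ g)₂₁ = 0`) then the slice `ι_w g` lies in the Siegel parabolic ★ `IsSiegelDelta` (★ desk letter `isSiegelDelta_archPiEquivCM_symm_mulSingle_iff` + §1).
[cite: GelbartRogawski1991, §3.1] [cite: Shimura1997, §6] -/
theorem isSiegelDelta_slice_of_toBlocks₂₁ (D C : Matrix (Fin n) (Fin n) ℂ) (Tinv : Matrix (Fin n ⊕ Fin n) (Fin n ⊕ Fin n) ℂ)
    (hinv : Tinv * Matrix.fromBlocks D D C (-C) = 1) (hC : IsUnit C.det) (g : archLocal L (n + n) (hermD L e dV hdV dW hdW) w)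
    (hP : (Matrix.fromBlocks D D C (-C) * Matrix.reindex (e₂ (n := n)).symm (e₂ (n := n)).symm ((g : GL (Fin (n + n)) ℂ) : Matrix (Fin (n + n)) (Fin (n + n)) ℂ) * Tinv).toBlocks₂₁ = 0) :
    IsSiegelDelta L e dV hdV dW hdW (archToAdelic (Fp L) L (IsCMField.complexConj L) (n + n) (hermD L e dV hdV dW hdW)
      ((archPiEquivCM (n + n) L (hermD L e dV hdV dW hdW)).symm (Pi.mulSingle w g))) :=
  (isSiegelDelta_archPiEquivCM_symm_mulSingle_iff L e dV hdV dW hdW w g).2 (isSiegelM_and_toBlocks₁₁_mul_of_tube D C Tinv hinv hC _ hP).1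

/-- Kudla's `x` of the place component OFF `w` is `1` (the component is `1`, ★ `detDeltaM_one`). [cite: Kudla1994, §3] -/
theorem detDeltaM_archAt_slice_of_ne (g : archLocal L (n + n) (hermD L e dV hdV dW hdW) w) {w' : {w : InfinitePlace L // w.IsComplex}} (hw' : w' ≠ w) :
    detDeltaM (n := n) (((archAt (Fp L) L (IsCMField.complexConj L) (n + n) (hermD L e dV hdV dW hdW) w' (complexConj_smul_infinitePlace L w'.1) (IsCMField.complexConj_ne_one L)
        ((archPiEquivCM (n + n) L (hermD L e dV hdV dW hdW)).symm (Pi.mulSingle w g)) : archLocal L (n + n) (hermD L e dV hdV dW hdW) w') : GL (Fin (n + n)) ℂ) :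
          Matrix (Fin (n + n)) (Fin (n + n)) ℂ) = 1 := by
  rw [archAt_slice, Pi.mulSingle_eq_of_ne hw', OneMemClass.coe_one, Units.val_one]
  exact detDeltaM_one

/-- Kudla's `x` of the place component AT `w` is `det (τ g)₁₁` for a tube-Siegel image (§1). [cite: Kudla1994, §3] [cite: Shimura1997, §6] -/
theorem detDeltaM_archAt_slice_self (D C : Matrix (Fin n) (Fin n) ℂ) (Tinv : Matrix (Fin n ⊕ Fin n) (Fin n ⊕ Fin n) ℂ)
    (hinv : Tinv * Matrix.fromBlocks D D C (-C) = 1) (hD : IsUnit D.det) (hC : IsUnit C.det) (g : archLocal L (n + n) (hermD L e dV hdV dW hdW) w)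
    (hP : (Matrix.fromBlocks D D C (-C) * Matrix.reindex (e₂ (n := n)).symm (e₂ (n := n)).symm ((g : GL (Fin (n + n)) ℂ) : Matrix (Fin (n + n)) (Fin (n + n)) ℂ) * Tinv).toBlocks₂₁ = 0) :
    detDeltaM (n := n) (((archAt (Fp L) L (IsCMField.complexConj L) (n + n) (hermD L e dV hdV dW hdW) w (complexConj_smul_infinitePlace L w.1) (IsCMField.complexConj_ne_one L)
        ((archPiEquivCM (n + n) L (hermD L e dV hdV dW hdW)).symm (Pi.mulSingle w g)) : archLocal L (n + n) (hermD L e dV hdV dW hdW) w) : GL (Fin (n + n)) ℂ) :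
          Matrix (Fin (n + n)) (Fin (n + n)) ℂ) =
      (Matrix.fromBlocks D D C (-C) * Matrix.reindex (e₂ (n := n)).symm (e₂ (n := n)).symm ((g : GL (Fin (n + n)) ℂ) : Matrix (Fin (n + n)) (Fin (n + n)) ℂ) * Tinv).toBlocks₁₁.det := by
  rw [archAt_slice, Pi.mulSingle_eq_same]
  exact detDeltaM_eq_det_toBlocks₁₁_of_tube D C Tinv hinv hD hC _ hP

end Slice

/-! ## §3 The idele `det_Δ(ι_w g)`: finite part, place components, `chiDet`, `modDelta` -/
section Idele
variable (L : Type) [Field L] [NumberField L] [IsCMField L]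
variable {N M n : ℕ} (e : Fin N × Fin M ≃ Fin n)
  (dV : Fin N → L) (hdV : ∀ i, IsCMField.complexConj L (dV i) = dV i)
  (dW : Fin M → L) (hdW : ∀ i, IsCMField.complexConj L (dW i) = dW i)
  (w : {w : InfinitePlace L // w.IsComplex})

/-- every infinite place of the CM field `L` is complex. [folklore] -/
theorem isComplex_infinitePlace (v : InfinitePlace L) : v.IsComplex :=
  not_isReal_iff_isComplex.1 fun h => (K2LiuArchSliceSiegel.isEmpty_isReal L).false ⟨v, h⟩

/-- the FINITE part of `det_Δ` of an archimedean element `(a, 1)` is `1` (★ `snd_det_deltaBlock_archToAdelic`). [cite: Kudla1994, §3] [cite: BorelJacquet1979, §4.1] -/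
theorem snd_detDelta_archToAdelic (a : arch (Fp L) L (IsCMField.complexConj L) (n + n) (hermD L e dV hdV dW hdW)) :
    (detDelta L e dV hdV dW hdW (archToAdelic (Fp L) L (IsCMField.complexConj L) (n + n) (hermD L e dV hdV dW hdW) a)).2 = 1 :=
  ArchSplitting.snd_det_deltaBlock_archToAdelic (Fp L) L (IsCMField.complexConj L) (hermD L e dV hdV dW hdW) a

/-- the `w′`-component of `det_Δ (a, 1)` read in `ℂ` is Kudla's `x` of the place component `a_{w′}` (★ `extensionEmbedding_fst_det_deltaBlock_archToAdelic`).
[cite: Kudla1994, §3] [cite: BorelJacquet1979, §4.1] -/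
theorem extensionEmbedding_detDelta_archToAdelic (a : arch (Fp L) L (IsCMField.complexConj L) (n + n) (hermD L e dV hdV dW hdW)) (w' : {w : InfinitePlace L // w.IsComplex}) :
    Completion.extensionEmbedding w'.1 ((detDelta L e dV hdV dW hdW (archToAdelic (Fp L) L (IsCMField.complexConj L) (n + n) (hermD L e dV hdV dW hdW) a)).1 w'.1) =
      detDeltaM (n := n) (((archAt (Fp L) L (IsCMField.complexConj L) (n + n) (hermD L e dV hdV dW hdW) w' (complexConj_smul_infinitePlace L w'.1) (IsCMField.complexConj_ne_one L) a :
        archLocal L (n + n) (hermD L e dV hdV dW hdW) w') : GL (Fin (n + n)) ℂ) : Matrix (Fin (n + n)) (Fin (n + n)) ℂ) :=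
  ArchSplitting.extensionEmbedding_fst_det_deltaBlock_archToAdelic (Fp L) L (IsCMField.complexConj L) (hermD L e dV hdV dW hdW) w'
    (complexConj_smul_infinitePlace L w'.1) (IsCMField.complexConj_ne_one L) a

/-- **THE UNIT `det_Δ(a,1)` AS AN INFINITE IDELE**: for `(a, 1) ∈ P_Δ(𝔸)` the unit `det_Δ (a,1)` (★ `isUnit_detDelta_of_isSiegelDelta`) is `(y, 1)` with `y` its infinite part
(★ `infiniteIdeles`). [cite: Kudla1994, §3] [cite: TateThesis1967, §4.3] -/
theorem unit_detDelta_archToAdelic_eq_infiniteIdeles (a : arch (Fp L) L (IsCMField.complexConj L) (n + n) (hermD L e dV hdV dW hdW))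
    (hu : IsUnit (detDelta L e dV hdV dW hdW (archToAdelic (Fp L) L (IsCMField.complexConj L) (n + n) (hermD L e dV hdV dW hdW) a))) :
    hu.unit = infiniteIdeles L (Units.map (adeleFst L : AdeleRing (𝓞 L) L →* InfiniteAdeleRing L) hu.unit) := by
  apply Units.ext
  change (hu.unit : AdeleRing (𝓞 L) L) = ((((hu.unit : ideleGroup L) : AdeleRing (𝓞 L) L).1, (1 : FiniteAdeleRing (𝓞 L) L)) : AdeleRing (𝓞 L) L)
  refine Prod.ext rfl ?_
  change ((hu.unit : ideleGroup L) : AdeleRing (𝓞 L) L).2 = 1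
  rw [IsUnit.unit_spec]
  exact snd_detDelta_archToAdelic L e dV hdV dW hdW a

/-- **`χ′(det_Δ (a,1))` BY ARCHIMEDEAN TYPE**: for `χ′` of unitary archimedean type `(t, 0)` and `(a,1) ∈ P_Δ(𝔸)`,
`chiDet χ′ (a,1) = ∏_{w′} (x(a_{w′}) ∕ ‖x(a_{w′})‖)^{t w′}` over the (complex) places `w′` of `L`. [cite: Patrikis2019, §2.1] [cite: Kudla1994, §3] [cite: HarrisKudlaSweet1996, §1 (1.15)] -/
theorem chiDet_archToAdelic_eq_prod (a : arch (Fp L) L (IsCMField.complexConj L) (n + n) (hermD L e dV hdV dW hdW))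
    (hS : IsSiegelDelta L e dV hdV dW hdW (archToAdelic (Fp L) L (IsCMField.complexConj L) (n + n) (hermD L e dV hdV dW hdW) a))
    {χ' : HeckeCharacter L} {t : InfinitePlace L → ℤ} (ht : χ'.HasUnitaryArchType t 0) :
    ((chiDet L e dV hdV dW hdW χ' (archToAdelic (Fp L) L (IsCMField.complexConj L) (n + n) (hermD L e dV hdV dW hdW) a) : ℂˣ) : ℂ) =
      ∏ w' : InfinitePlace L,
        archUnitaryValue (t w') 0 (detDeltaM (n := n) (((archAt (Fp L) L (IsCMField.complexConj L) (n + n) (hermD L e dV hdV dW hdW) ⟨w', isComplex_infinitePlace L w'⟩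
          (complexConj_smul_infinitePlace L w') (IsCMField.complexConj_ne_one L) a : archLocal L (n + n) (hermD L e dV hdV dW hdW) ⟨w', isComplex_infinitePlace L w'⟩) :
            GL (Fin (n + n)) ℂ) : Matrix (Fin (n + n)) (Fin (n + n)) ℂ)) := by
  have hu := isUnit_detDelta_of_isSiegelDelta L e dV hdV dW hdW _ hS
  unfold chiDet
  rw [dif_pos hu, unit_detDelta_archToAdelic_eq_infiniteIdeles L e dV hdV dW hdW a hu, ht _]
  refine Finset.prod_congr rfl fun w' _ => ?_
  have hy : ((Units.map (adeleFst L : AdeleRing (𝓞 L) L →* InfiniteAdeleRing L) hu.unit : (InfiniteAdeleRing L)ˣ) : InfiniteAdeleRing L) w' =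
      (detDelta L e dV hdV dW hdW (archToAdelic (Fp L) L (IsCMField.complexConj L) (n + n) (hermD L e dV hdV dW hdW) a)).1 w' := by
    rw [Units.coe_map, IsUnit.unit_spec]
    rfl
  rw [hy, extensionEmbedding_detDelta_archToAdelic L e dV hdV dW hdW a ⟨w', isComplex_infinitePlace L w'⟩]
  rfl

/-- **`|det_Δ (a,1)|_{𝔸_L}^{1∕2}` PLACE BY PLACE**: `modDelta (a,1) = ∏_{w′} ‖x(a_{w′})‖` (a complex place has local degree `2`, so `|z|_w = ‖z‖²`). [cite: TateThesis1967, §4.3]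
[cite: Kudla1994, §3] [cite: HarrisKudlaSweet1996, §1 (1.11)–(1.12)] -/
theorem modDelta_archToAdelic_eq_prod (a : arch (Fp L) L (IsCMField.complexConj L) (n + n) (hermD L e dV hdV dW hdW))
    (hS : IsSiegelDelta L e dV hdV dW hdW (archToAdelic (Fp L) L (IsCMField.complexConj L) (n + n) (hermD L e dV hdV dW hdW) a)) :
    modDelta L e dV hdV dW hdW (archToAdelic (Fp L) L (IsCMField.complexConj L) (n + n) (hermD L e dV hdV dW hdW) a) =
      ∏ w' : InfinitePlace L,
        ‖detDeltaM (n := n) (((archAt (Fp L) L (IsCMField.complexConj L) (n + n) (hermD L e dV hdV dW hdW) ⟨w', isComplex_infinitePlace L w'⟩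
          (complexConj_smul_infinitePlace L w') (IsCMField.complexConj_ne_one L) a : archLocal L (n + n) (hermD L e dV hdV dW hdW) ⟨w', isComplex_infinitePlace L w'⟩) :
            GL (Fin (n + n)) ℂ) : Matrix (Fin (n + n)) (Fin (n + n)) ℂ)‖ := by
  have hu := isUnit_detDelta_of_isSiegelDelta L e dV hdV dW hdW _ hS
  unfold modDelta
  rw [dif_pos hu, unit_detDelta_archToAdelic_eq_infiniteIdeles L e dV hdV dW hdW a hu]
  -- the idelic modulus of an infinite idele of a CM field, place by place
  have hsq : ideleNorm (infiniteIdeles L (Units.map (adeleFst L : AdeleRing (𝓞 L) L →* InfiniteAdeleRing L) hu.unit)) =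
      ∏ w' : InfinitePlace L, ‖detDeltaM (n := n) (((archAt (Fp L) L (IsCMField.complexConj L) (n + n) (hermD L e dV hdV dW hdW) ⟨w', isComplex_infinitePlace L w'⟩
          (complexConj_smul_infinitePlace L w') (IsCMField.complexConj_ne_one L) a : archLocal L (n + n) (hermD L e dV hdV dW hdW) ⟨w', isComplex_infinitePlace L w'⟩) :
            GL (Fin (n + n)) ℂ) : Matrix (Fin (n + n)) (Fin (n + n)) ℂ)‖ ^ 2 := by
    unfold ideleNorm
    have h2 : ((infiniteIdeles L (Units.map (adeleFst L : AdeleRing (𝓞 L) L →* InfiniteAdeleRing L) hu.unit) : ideleGroup L) : AdeleRing (𝓞 L) L).2 = 1 := rfl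
    have h3 : ∀ v : HeightOneSpectrum (𝓞 L), (1 : FiniteAdeleRing (𝓞 L) L) v = 1 := fun v => rfl
    rw [h2, finprod_eq_one_of_forall_eq_one fun v => by rw [h3 v, norm_one], mul_one]
    refine Finset.prod_congr rfl fun w' _ => ?_
    have hm : (w' : InfinitePlace L).mult = 2 := mult_isComplex ⟨w', isComplex_infinitePlace L w'⟩
    have hy : ((infiniteIdeles L (Units.map (adeleFst L : AdeleRing (𝓞 L) L →* InfiniteAdeleRing L) hu.unit) : ideleGroup L) : AdeleRing (𝓞 L) L).1 w' =
        (detDelta L e dV hdV dW hdW (archToAdelic (Fp L) L (IsCMField.complexConj L) (n + n) (hermD L e dV hdV dW hdW) a)).1 w' := by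
      show ((Units.map (adeleFst L : AdeleRing (𝓞 L) L →* InfiniteAdeleRing L) hu.unit : (InfiniteAdeleRing L)ˣ) : InfiniteAdeleRing L) w' = _
      rw [Units.coe_map, IsUnit.unit_spec]
      rfl
    rw [hm, hy, ← extensionEmbedding_detDelta_archToAdelic L e dV hdV dW hdW a ⟨w', isComplex_infinitePlace L w'⟩,
      (Completion.isometry_extensionEmbedding w').norm_map_of_map_zero (map_zero _)]
  rw [hsq, Finset.prod_pow, Real.sqrt_sq (Finset.prod_nonneg fun _ _ => norm_nonneg _)]

end Idele

/-! ## §4 The dictionary -/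
section Dictionary
variable (L : Type) [Field L] [NumberField L] [IsCMField L]
variable {N M n : ℕ} (e : Fin N × Fin M ≃ Fin n)
  (dV : Fin N → L) (hdV : ∀ i, IsCMField.complexConj L (dV i) = dV i)
  (dW : Fin M → L) (hdW : ∀ i, IsCMField.complexConj L (dW i) = dW i)
  (w : {w : InfinitePlace L // w.IsComplex})

/-- `archUnitaryValue m 0 1 = 1`. [folklore] -/
theorem archUnitaryValue_zero_right_one (m : ℤ) : archUnitaryValue m 0 1 = 1 := by
  rw [HeckeCharacter.CMQuadraticExtension.archUnitaryValue_zero_right, norm_one, Complex.ofReal_one, div_one, one_zpow]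

/-- **(law), RAW FORM.**  For the frame `T = (D D; C −C)`, `Tinv · T = 1`, `D`, `C` invertible, a complex place `w`, `g ∈ U(σ_w J^𝔻)(ℂ)` with tube-Siegel image (`(τ g)₂₁ = 0`),
a Hecke character `χ′` of unitary archimedean type `(t, 0)` and `s′ ∈ ℂ`:
`siegelDeltaCharacter χ′ s′ (ι_w g) = (z∕‖z‖)^{t w} · ‖z‖^{2s′+n}`, `z = det (τ g)₁₁`. [cite: Kudla1994, §3] [cite: HarrisKudlaSweet1996, §1 (1.15)] [cite: Shimura1997, §16.4]
[cite: Patrikis2019, §2.1] -/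
theorem siegelDeltaCharacter_slice (D C : Matrix (Fin n) (Fin n) ℂ) (Tinv : Matrix (Fin n ⊕ Fin n) (Fin n ⊕ Fin n) ℂ)
    (hinv : Tinv * Matrix.fromBlocks D D C (-C) = 1) (hD : IsUnit D.det) (hC : IsUnit C.det) (g : archLocal L (n + n) (hermD L e dV hdV dW hdW) w)
    (hP : (Matrix.fromBlocks D D C (-C) * Matrix.reindex (e₂ (n := n)).symm (e₂ (n := n)).symm ((g : GL (Fin (n + n)) ℂ) : Matrix (Fin (n + n)) (Fin (n + n)) ℂ) * Tinv).toBlocks₂₁ = 0)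
    {χ' : HeckeCharacter L} {t : InfinitePlace L → ℤ} (ht : χ'.HasUnitaryArchType t 0) (s' : ℂ) :
    siegelDeltaCharacter L e dV hdV dW hdW χ' s' (archToAdelic (Fp L) L (IsCMField.complexConj L) (n + n) (hermD L e dV hdV dW hdW)
        ((archPiEquivCM (n + n) L (hermD L e dV hdV dW hdW)).symm (Pi.mulSingle w g))) =
      ((Matrix.fromBlocks D D C (-C) * Matrix.reindex (e₂ (n := n)).symm (e₂ (n := n)).symm ((g : GL (Fin (n + n)) ℂ) : Matrix (Fin (n + n)) (Fin (n + n)) ℂ) * Tinv).toBlocks₁₁.det /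
          ((‖(Matrix.fromBlocks D D C (-C) * Matrix.reindex (e₂ (n := n)).symm (e₂ (n := n)).symm ((g : GL (Fin (n + n)) ℂ) : Matrix (Fin (n + n)) (Fin (n + n)) ℂ) * Tinv).toBlocks₁₁.det‖ : ℝ) : ℂ)) ^ (t w.1) *
        (((‖(Matrix.fromBlocks D D C (-C) * Matrix.reindex (e₂ (n := n)).symm (e₂ (n := n)).symm ((g : GL (Fin (n + n)) ℂ) : Matrix (Fin (n + n)) (Fin (n + n)) ℂ) * Tinv).toBlocks₁₁.det‖ : ℝ) : ℂ)) ^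
          (2 * s' + (n : ℂ)) := by
  set a := (archPiEquivCM (n + n) L (hermD L e dV hdV dW hdW)).symm (Pi.mulSingle w g) with ha
  set z := (Matrix.fromBlocks D D C (-C) * Matrix.reindex (e₂ (n := n)).symm (e₂ (n := n)).symm ((g : GL (Fin (n + n)) ℂ) : Matrix (Fin (n + n)) (Fin (n + n)) ℂ) * Tinv).toBlocks₁₁.det
    with hz
  have hS := isSiegelDelta_slice_of_toBlocks₂₁ L e dV hdV dW hdW w D C Tinv hinv hC g hP
  have hx : ∀ w' : InfinitePlace L,
      detDeltaM (n := n) (((archAt (Fp L) L (IsCMField.complexConj L) (n + n) (hermD L e dV hdV dW hdW) ⟨w', isComplex_infinitePlace L w'⟩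
          (complexConj_smul_infinitePlace L w') (IsCMField.complexConj_ne_one L) a : archLocal L (n + n) (hermD L e dV hdV dW hdW) ⟨w', isComplex_infinitePlace L w'⟩) :
            GL (Fin (n + n)) ℂ) : Matrix (Fin (n + n)) (Fin (n + n)) ℂ) = if w' = w.1 then z else 1 := by
    intro w'
    split_ifs with hw
    · subst hw
      exact detDeltaM_archAt_slice_self L e dV hdV dW hdW w D C Tinv hinv hD hC g hP
    · exact detDeltaM_archAt_slice_of_ne L e dV hdV dW hdW w g (fun h => hw (congrArg Subtype.val h))
  have hprod₁ : (∏ w' : InfinitePlace L,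
        archUnitaryValue (t w') 0 (detDeltaM (n := n) (((archAt (Fp L) L (IsCMField.complexConj L) (n + n) (hermD L e dV hdV dW hdW) ⟨w', isComplex_infinitePlace L w'⟩
          (complexConj_smul_infinitePlace L w') (IsCMField.complexConj_ne_one L) a : archLocal L (n + n) (hermD L e dV hdV dW hdW) ⟨w', isComplex_infinitePlace L w'⟩) :
            GL (Fin (n + n)) ℂ) : Matrix (Fin (n + n)) (Fin (n + n)) ℂ))) = (z / (‖z‖ : ℂ)) ^ (t w.1) := by
    rw [Fintype.prod_eq_single (w.1 : InfinitePlace L) (fun w' hw' => by rw [hx, if_neg hw', archUnitaryValue_zero_right_one]), hx, if_pos rfl,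
      HeckeCharacter.CMQuadraticExtension.archUnitaryValue_zero_right]
  have hprod₂ : (∏ w' : InfinitePlace L,
        ‖detDeltaM (n := n) (((archAt (Fp L) L (IsCMField.complexConj L) (n + n) (hermD L e dV hdV dW hdW) ⟨w', isComplex_infinitePlace L w'⟩
          (complexConj_smul_infinitePlace L w') (IsCMField.complexConj_ne_one L) a : archLocal L (n + n) (hermD L e dV hdV dW hdW) ⟨w', isComplex_infinitePlace L w'⟩) :
            GL (Fin (n + n)) ℂ) : Matrix (Fin (n + n)) (Fin (n + n)) ℂ)‖) = ‖z‖ := by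
    rw [Fintype.prod_eq_single (w.1 : InfinitePlace L) (fun w' hw' => by rw [hx, if_neg hw', norm_one]), hx, if_pos rfl]
  unfold siegelDeltaCharacter
  rw [chiDet_archToAdelic_eq_prod L e dV hdV dW hdW a hS ht, modDelta_archToAdelic_eq_prod L e dV hdV dW hdW a hS, hprod₁, hprod₂]

/-- `z ∕ ‖z‖ = (conj z ∕ ‖z‖)⁻¹` for `z ≠ 0` (`z · conj z = ‖z‖²`). [folklore] -/
theorem div_norm_eq_conj_div_norm_inv {z : ℂ} (hz : z ≠ 0) : z / (‖z‖ : ℂ) = (conj z / (‖z‖ : ℂ))⁻¹ := by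
  have hn : (‖z‖ : ℂ) ≠ 0 := by exact_mod_cast norm_ne_zero_iff.2 hz
  have hc : conj z ≠ 0 := (map_ne_zero (starRingEnd ℂ)).2 hz
  rw [inv_div, div_eq_div_iff hn hc, Complex.mul_conj, Complex.normSq_eq_norm_sq]
  push_cast
  ring

/-- **(law) — THE DICTIONARY (desk head (T1)).**  Same hypotheses: `siegelDeltaCharacter χ′ s′ (ι_w g) = (conj z ∕ ‖z‖)^{−t w} · ‖z‖^{2s′+n}`, `z = det (τ g)₁₁` — the tube model's
Siegel-parabolic character `χ_k(det p₁₁)·‖det p₁₁‖^{2s+n}` (★ `K2LiuArchInducedTubeDefs.IsArchSiegelSection`) with `χ_k(z) = (z̄∕|z|)^k`, WEIGHT `k = −t_w` and `s = s′`.  For the S2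
packaging's `χ′ := χ^{M₂}` (type `M₂ • t`), `s′ := (M₂ − n)∕2`: `k_w = −M₂·t_w`. [cite: Shimura1997, §16.4] [cite: Kudla1994, §3] [cite: HarrisKudlaSweet1996, §1 (1.15)] [cite: Patrikis2019, §2.1] -/
theorem siegelDeltaCharacter_archPlace (D C : Matrix (Fin n) (Fin n) ℂ) (Tinv : Matrix (Fin n ⊕ Fin n) (Fin n ⊕ Fin n) ℂ)
    (hinv : Tinv * Matrix.fromBlocks D D C (-C) = 1) (hD : IsUnit D.det) (hC : IsUnit C.det) (g : archLocal L (n + n) (hermD L e dV hdV dW hdW) w)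
    (hP : (Matrix.fromBlocks D D C (-C) * Matrix.reindex (e₂ (n := n)).symm (e₂ (n := n)).symm ((g : GL (Fin (n + n)) ℂ) : Matrix (Fin (n + n)) (Fin (n + n)) ℂ) * Tinv).toBlocks₂₁ = 0)
    {χ' : HeckeCharacter L} {t : InfinitePlace L → ℤ} (ht : χ'.HasUnitaryArchType t 0) (s' : ℂ) :
    siegelDeltaCharacter L e dV hdV dW hdW χ' s' (archToAdelic (Fp L) L (IsCMField.complexConj L) (n + n) (hermD L e dV hdV dW hdW)
        ((archPiEquivCM (n + n) L (hermD L e dV hdV dW hdW)).symm (Pi.mulSingle w g))) =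
      (fun z : ℂ => (conj z / ((‖z‖ : ℝ) : ℂ)) ^ (-(t w.1)))
          (Matrix.fromBlocks D D C (-C) * Matrix.reindex (e₂ (n := n)).symm (e₂ (n := n)).symm ((g : GL (Fin (n + n)) ℂ) : Matrix (Fin (n + n)) (Fin (n + n)) ℂ) * Tinv).toBlocks₁₁.det *
        (((‖(Matrix.fromBlocks D D C (-C) * Matrix.reindex (e₂ (n := n)).symm (e₂ (n := n)).symm ((g : GL (Fin (n + n)) ℂ) : Matrix (Fin (n + n)) (Fin (n + n)) ℂ) * Tinv).toBlocks₁₁.det‖ : ℝ) : ℂ)) ^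
          (2 * s' + (n : ℂ)) := by
  rw [siegelDeltaCharacter_slice L e dV hdV dW hdW w D C Tinv hinv hD hC g hP ht s']
  have hz := det_toBlocks₁₁_ne_zero_of_tube (Matrix.fromBlocks D D C (-C)) Tinv hinv ((g : GL (Fin (n + n)) ℂ) : Matrix (Fin (n + n)) (Fin (n + n)) ℂ)
    ((Matrix.isUnit_iff_isUnit_det _).1 (g : GL (Fin (n + n)) ℂ).isUnit) hP
  beta_reduce
  rw [div_norm_eq_conj_div_norm_inv hz, inv_zpow']

end Dictionary

/-! ## §5 The Shimura letters of ★ `exists_tubeFrame_arch₄` (x) satisfy the frame hypotheses -/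
section Shimura
variable {n : ℕ}

/-- a diagonal matrix with non-zero entries has unit determinant. [folklore] -/
theorem isUnit_det_diagonal_of_ne_zero {d : Fin n → ℂ} (hd : ∀ k, d k ≠ 0) : IsUnit (Matrix.diagonal d).det := by
  rw [Matrix.det_diagonal]
  exact isUnit_iff_ne_zero.2 (Finset.prod_ne_zero_iff.2 fun k _ => hd k)

/-- **THE SHIMURA FRAME LETTERS ARE INVERTIBLE**: for `t : Fin n → ℝ` nowhere zero, the blocks `D = diag(√(|t|∕2))` and `C₀ = diag(i · (t∕|t|) · √(|t|∕2))` of the explicit frame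
`T = (D D; C₀ −C₀)` of ★ `K2LiuHermitianTubeFrameSign.exists_tubeFrame_arch₄` (x) (there `t k = Re σ_w(dV_{(e⁻¹k).1} dW_{(e⁻¹k).2})`, nowhere zero by ★ `tw_ne_zero`) have unit
determinants — the binders `hD`, `hC` of §1–§4. [cite: Shimura1997, §6.5] -/
theorem isUnit_det_shimuraFrame (t : Fin n → ℝ) (ht : ∀ k, t k ≠ 0) :
    IsUnit (Matrix.diagonal fun k => (Real.sqrt (|t k| / 2) : ℂ)).det ∧
      IsUnit (Matrix.diagonal fun k => Complex.I * (((t k / |t k|) * Real.sqrt (|t k| / 2) : ℝ) : ℂ)).det := by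
  have hsq : ∀ k, Real.sqrt (|t k| / 2) ≠ 0 := fun k => (Real.sqrt_pos.2 (div_pos (abs_pos.2 (ht k)) two_pos)).ne'
  refine ⟨isUnit_det_diagonal_of_ne_zero fun k => ?_, isUnit_det_diagonal_of_ne_zero fun k => ?_⟩
  · exact_mod_cast hsq k
  · refine mul_ne_zero Complex.I_ne_zero ?_
    exact_mod_cast mul_ne_zero (div_ne_zero (ht k) (abs_ne_zero.2 (ht k))) (hsq k)

end Shimura

end Summit.HodgeConjecture.HodgeConjecture.Cruxes.HLiu418.K2LiuArchSiegelCharacterTube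

end
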